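import Mathlib
import HarnessLib
import Summits.Langlands.Langlands.Statement
import Summits.Langlands.Langlands.Theorems.SkinnerWilesDefectOneEisensteinProModularSeedQuadraticBaseChangeTwistNonDihedral
import Literature.NumberTheory.Automorphic.BaseChangeCyclicCuspidal
import Literature.NumberTheory.Automorphic.QuadraticBaseChangeFrobCompatible
import Literature.NumberTheory.Automorphic.QuadraticBaseChangeFrobCompatibleProofs
import Summits.Langlands.Langlands.Theses.SkinnerWilesDefectOne

/-!
# `QuadraticBaseChangeGalois` (item stmt-Langlands-15156 of route `SkinnerWilesDefectOne`)
# from the three named base-change facts — the certificate, kernel-checked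

The item (promoted import; Langlands' quadratic base change for `GL₂` from `ℚ` to a quadratic field
`F`, in the Galois-compatible form consumed by stub S4 `stub_quadraticBaseChangeTwist` of the crux
`EisensteinProModularSeed`): for `F/ℚ` quadratic, `p`, `ι : ℚ̄_p ≃ ℂ`, `π` cuspidal on `GL₂(𝔸_ℚ)`
with a regular L-algebraic infinity type `T`, `ρ : Γ_ℚ → GL₂(ℚ̄_p)` Satake–Frobenius compatible with
`π` at almost all places and with `ρ|_{Γ_F}` irreducible, there is a CUSPIDAL `P` on `GL₂(𝔸_F)` of
infinity type `T^F : τ ↦ T(τ|_ℚ)` with `SatakeFrobCompatibleAt ι P (ρ|_{Γ_F}) w` at every finite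
`w ∤ p` at which `ρ|_{Γ_F}` is unramified.

This file proves it — with the conclusion written out verbatim (the route decl is linked in a later
proposal) and for EVERY quadratic `F`, real or imaginary — from the three named facts of the tree, in
this order:

1. `Literature.NumberTheory.Automorphic.baseChange_cyclic_cuspidal` (Arthur–Clozel 1989, Ch. 3,
   Thm. 4.2 (a), datum model): a cuspidal weak base-change lift `P` of `π` exists once `π` has, at
   some place inert in `F`, a Satake parameter `α` with `-α ≠ α`; that hypothesis is supplied by the
   PROVED non-dihedral lemma `exists_inert_hasSatakeParamAt_map_ne` (Chebotarev + Brauer–Nesbitt +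
   Schur, file `…QuadraticBaseChangeTwistNonDihedral`) from the irreducibility of `ρ|_{Γ_F}`;
2. `Literature.NumberTheory.Automorphic.ArthurClozel1989_strongLifting_archimedean` (Arthur–Clozel
   Thm. 5.1 with Ch. 1 §7): `P` has infinity type `T.baseChange F = fun τ ↦ T (τ.comp (algebraMap ℚ F))`;
3. `Literature.NumberTheory.Automorphic.Langlands1980_quadraticBaseChange_frobCompatible`
   (Langlands 1980 + Arthur–Clozel Thm. 5.1 + Carayol 1986 Thm. (A), §12.2): `P` is Satake–Frobenius
   compatible with `ρ|_{Γ_F}` at every `w ∤ p` where the latter is unramified (it needs `ρ`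
   irreducible, which follows from the irreducibility of `ρ|_{Γ_F}`:
   `isIrreducible_of_isIrreducible_restrictField`).

So the item is IMPLIED by the accepted literature package (never stronger); it stays CONDITIONAL on
facts 1–3, none of which is discharged in the tree for `n = 2` (the `_holds` theorems exist only in
rank one).  What each fact still owes at `n = 2`, `K = ℚ` is recorded in the seat's census
(stmt-Langlands-15156).
-/

set_option linter.dupNamespace false -- project-wide option (lakefile weak.linter.dupNamespace); `Summit.Langlands.Langlands` is the mandated namespace

noncomputable section

open scoped MatrixGroups Matrix NumberField Polynomial Classical
open NumberField IsDedekindDomain Field Polynomial Filter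
open Literature.NumberTheory.Automorphic Literature.NumberTheory.GaloisRepresentations

namespace Summit.Langlands.Langlands.Theorems.SkinnerWilesDefectOne

/-- **Irreducibility of `ρ|_{Γ_F}` implies irreducibility of `ρ`**: a `ρ`-stable subspace is
`ρ|_{Γ_F}`-stable (`isIrreducible_of_coe_eq_smul` with the restriction map `Γ_F → Γ_K` and trivial
scalars). [folklore] -/
theorem isIrreducible_of_isIrreducible_restrictField {K : Type} [Field K] [NumberField K]
    (F : Type) [Field F] [Algebra K F] {p : ℕ} [Fact p.Prime] {n : ℕ}
    (ρ : FramedGaloisRep K (PadicAlgCl p) n)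
    (h : (ρ.restrictField F).toGaloisRep.IsIrreducible) : ρ.toGaloisRep.IsIrreducible :=
  EisensteinProModularSeed.isIrreducible_of_coe_eq_smul (ρ.restrictField F) ρ
    (absGaloisRestrict K F) (fun _ => 1)
    (fun σ => by rw [one_smul, FramedGaloisRep.restrictField_apply]) h

/-- **`QuadraticBaseChangeGalois` from the three named facts** (the certificate of item
stmt-Langlands-15156, conclusion written out verbatim; valid for every quadratic `F/ℚ`).  Granted
(1) `baseChange_cyclic_cuspidal`, (2) `ArthurClozel1989_strongLifting_archimedean` and
(3) `Langlands1980_quadraticBaseChange_frobCompatible`: for `F/ℚ` quadratic, `π` cuspidal on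
`GL₂(𝔸_ℚ)` with a regular L-algebraic infinity type `T`, `ρ : Γ_ℚ → GL₂(ℚ̄_p)` Satake–Frobenius
compatible with `π` almost everywhere with `ρ|_{Γ_F}` irreducible, the cuspidal base change `P` of
`π` (fact 1, cuspidal by the non-dihedral lemma) has infinity type `τ ↦ T(τ|_ℚ)` (fact 2) and is
Satake–Frobenius compatible with `ρ|_{Γ_F}` at every finite `w ∤ p` where `ρ|_{Γ_F}` is unramified
(fact 3).
[cite: LanglandsBaseChange1980, global base change lifting for GL(2)]
[cite: ArthurClozelAMS120, Ch. 3 Thm. 4.2 (a) and Thm. 5.1] [cite: CarayolASENS1986, Thm. (A) and §12.2] -/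
theorem quadraticBaseChangeGalois_of_facts
    (h₁ : Literature.NumberTheory.Automorphic.baseChange_cyclic_cuspidal)
    (h₂ : Literature.NumberTheory.Automorphic.ArthurClozel1989_strongLifting_archimedean)
    (h₃ : Literature.NumberTheory.Automorphic.Langlands1980_quadraticBaseChange_frobCompatible) :
    ∀ (F : Type) [Field F] [NumberField F], Module.finrank ℚ F = 2 →
      ∀ (p : ℕ) [Fact p.Prime]
        (hcptQ : Literature.NumberTheory.Automorphic.isCompact_glFiniteIntegralLevel 2 ℚ)
        (hcptF : Literature.NumberTheory.Automorphic.isCompact_glFiniteIntegralLevel 2 F)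
        (ι : PadicAlgCl p ≃+* ℂ)
        (π : Literature.NumberTheory.Automorphic.CuspidalAutomorphicRepData 2 ℚ hcptQ)
        (T : Literature.NumberTheory.Automorphic.InfinityType ℚ 2),
      π.1.HasInfinityType T → T.IsLAlgebraic → T.IsRegular →
      ∀ (ρ : Literature.NumberTheory.GaloisRepresentations.FramedGaloisRep ℚ (PadicAlgCl p) 2),
      (∀ᶠ v in Filter.cofinite, Summit.Langlands.SatakeFrobCompatibleAt ι π.1 ρ v) →
      (ρ.restrictField F).toGaloisRep.IsIrreducible →
      ∃ P : Literature.NumberTheory.Automorphic.CuspidalAutomorphicRepData 2 F hcptF,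
        P.1.HasInfinityType (fun τ => T (τ.comp (algebraMap ℚ F))) ∧
        ∀ w : IsDedekindDomain.HeightOneSpectrum (NumberField.RingOfIntegers F),
          (p : NumberField.RingOfIntegers F) ∉ w.asIdeal → (ρ.restrictField F).IsUnramifiedAt w →
          Summit.Langlands.SatakeFrobCompatibleAt ι P.1 (ρ.restrictField F) w := by
  intro F _ _ hdeg p _ hcptQ hcptF ι π T hT hTL hTR ρ hcompat hirrF
  -- `F/ℚ` quadratic: Galois of prime degree `2`
  haveI : Algebra.IsQuadraticExtension ℚ F := ⟨hdeg⟩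
  haveI : IsGalois ℚ F := inferInstance
  have hprime : (Module.finrank ℚ F).Prime := hdeg ▸ Nat.prime_two
  -- `ρ` is irreducible since `ρ|_{Γ_F}` is
  have hρirr : ρ.toGaloisRep.IsIrreducible := isIrreducible_of_isIrreducible_restrictField F ρ hirrF
  -- fact 1 + the non-dihedral lemma: the cuspidal weak base-change lift `P`
  have hne :=
    EisensteinProModularSeed.exists_inert_hasSatakeParamAt_map_ne F hdeg ι π.1 ρ hcompat hirrF
  obtain ⟨P, hBC⟩ := h₁ 2 ℚ F hprime hcptQ π hne hcptF
  -- fact 2: its infinity type is `T^F`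
  have hPT : P.1.HasInfinityType (T.baseChange F) :=
    h₂.hasInfinityType_baseChange inferInstance hprime hBC hT
  refine ⟨P, hPT, fun w hwp hunr => ?_⟩
  -- fact 3: compatibility at every `w ∤ p` where `ρ|_{Γ_F}` is unramified
  exact h₃ F hdeg p ι hcptQ hcptF π T hT hTL hTR ρ hρirr hcompat P hBC w hwp hunr

/-- **The "good primes" variant, from SHARED debts** (for the planner's choice; not the item).  Same
binders as the item, facts (1) `baseChange_cyclic_cuspidal` and (2)
`ArthurClozel1989_strongLifting_archimedean` as before, but fact (3) replaced by the two named facts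
shared with the reciprocity cruxes — Arthur–Clozel's strong lifting at ALL finite places
(`ArthurClozel1989_strongLifting_allFinite`, Ch. 3 Thm. 5.1) and lang.S27
(`exists_galoisRep_of_regularAlgebraic`, Harris–Lan–Taylor–Thorne Thm. A + Varma Cor. 9.3) — at the
price of restricting the compatibility to the finite `w ∤ p` lying over a prime at which `π` is
UNRAMIFIED (hypothesis `π.1.IsUnramifiedAt (w.under (𝓞 ℚ))`; there "`ρ|_{Γ_F}` unramified at `w`"
is a conclusion, not a hypothesis).  The tree theorem
`Langlands1980_quadraticBaseChange_frobCompatible_at_of_isUnramifiedAt_under` does the work; what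
this variant does NOT give is compatibility at the finitely many `w ∤ p` over ramified primes of `π`
where `ρ|_{Γ_F}` happens to be unramified (the `n = 2`-specific content of fact (3): Carayol's
Thm. (A) in Weil–Deligne form + Langlands' local lifting of ramified principal series).
[cite: ArthurClozelAMS120, Ch. 3 Thm. 4.2 (a) and Thm. 5.1]
[cite: HarrisLanTaylorThorneRMS2016, Thm. A] [cite: LanglandsBaseChange1980, §2 (A), (F)] -/
theorem quadraticBaseChangeGalois_goodPrimes_of_facts
    (h₁ : Literature.NumberTheory.Automorphic.baseChange_cyclic_cuspidal)
    (h₂ : Literature.NumberTheory.Automorphic.ArthurClozel1989_strongLifting_archimedean)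
    (hAC : Literature.NumberTheory.Automorphic.ArthurClozel1989_strongLifting_allFinite)
    (h27 : Literature.NumberTheory.Automorphic.exists_galoisRep_of_regularAlgebraic) :
    ∀ (F : Type) [Field F] [NumberField F], Module.finrank ℚ F = 2 →
      ∀ (p : ℕ) [Fact p.Prime]
        (hcptQ : Literature.NumberTheory.Automorphic.isCompact_glFiniteIntegralLevel 2 ℚ)
        (hcptF : Literature.NumberTheory.Automorphic.isCompact_glFiniteIntegralLevel 2 F)
        (ι : PadicAlgCl p ≃+* ℂ)
        (π : Literature.NumberTheory.Automorphic.CuspidalAutomorphicRepData 2 ℚ hcptQ)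
        (T : Literature.NumberTheory.Automorphic.InfinityType ℚ 2),
      π.1.HasInfinityType T → T.IsLAlgebraic → T.IsRegular →
      ∀ (ρ : Literature.NumberTheory.GaloisRepresentations.FramedGaloisRep ℚ (PadicAlgCl p) 2),
      (∀ᶠ v in Filter.cofinite, Summit.Langlands.SatakeFrobCompatibleAt ι π.1 ρ v) →
      (ρ.restrictField F).toGaloisRep.IsIrreducible →
      ∃ P : Literature.NumberTheory.Automorphic.CuspidalAutomorphicRepData 2 F hcptF,
        P.1.HasInfinityType (fun τ => T (τ.comp (algebraMap ℚ F))) ∧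
        ∀ w : IsDedekindDomain.HeightOneSpectrum (NumberField.RingOfIntegers F),
          (p : NumberField.RingOfIntegers F) ∉ w.asIdeal →
          π.1.IsUnramifiedAt (w.under (NumberField.RingOfIntegers ℚ)) →
          Summit.Langlands.SatakeFrobCompatibleAt ι P.1 (ρ.restrictField F) w := by
  intro F _ _ hdeg p _ hcptQ hcptF ι π T hT hTL hTR ρ hcompat hirrF
  haveI : Algebra.IsQuadraticExtension ℚ F := ⟨hdeg⟩
  haveI : IsGalois ℚ F := inferInstance
  have hprime : (Module.finrank ℚ F).Prime := hdeg ▸ Nat.prime_two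
  have hρirr : ρ.toGaloisRep.IsIrreducible := isIrreducible_of_isIrreducible_restrictField F ρ hirrF
  have hne :=
    EisensteinProModularSeed.exists_inert_hasSatakeParamAt_map_ne F hdeg ι π.1 ρ hcompat hirrF
  obtain ⟨P, hBC⟩ := h₁ 2 ℚ F hprime hcptQ π hne hcptF
  have hPT : P.1.HasInfinityType (T.baseChange F) :=
    h₂.hasInfinityType_baseChange inferInstance hprime hBC hT
  refine ⟨P, hPT, fun w hwp hπw => ?_⟩
  exact Langlands1980_quadraticBaseChange_frobCompatible_at_of_isUnramifiedAt_under hAC h27 hdeg ι π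
    hT hTL hTR ρ hρirr hcompat P hBC w hwp hπw

/-- **The route decl `QuadraticBaseChangeGalois`, closing-shaped and CONDITIONAL** (item
stmt-Langlands-15156 of route `SkinnerWilesDefectOne`): granted the three named base-change facts
(1) `baseChange_cyclic_cuspidal` (Arthur–Clozel 1989, Ch. 3, Thm. 4.2 (a): the weak lift of a
cuspidal `π ≇ π ⊗ η` is cuspidal), (2) `ArthurClozel1989_strongLifting_archimedean` (Thm. 5.1 with
Ch. 1 §7: infinity types restrict along the lift) and (3)
`Langlands1980_quadraticBaseChange_frobCompatible` (Langlands 1980 + Carayol 1986 Thm. (A), §12.2: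
compatibility with `ρ|_{Γ_F}` at every `w ∤ p` where it is unramified), the route statement
`Summit.Langlands.Langlands.Theses.SkinnerWilesDefectOne.QuadraticBaseChangeGalois` holds — its body
is, verbatim, the conclusion of the certificate `quadraticBaseChangeGalois_of_facts`.  The type is
literally the route decl (first step `unfold`); the result is a `conditional-result` on facts (1)–(3),
none of which is discharged in the tree at `n = 2`.
[cite: LanglandsBaseChange1980, global base change lifting for GL(2)]
[cite: ArthurClozelAMS120, Ch. 3 Thm. 4.2 (a) and Thm. 5.1] [cite: CarayolASENS1986, Thm. (A) and §12.2] -/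
theorem quadraticBaseChangeGalois_proof
    (h₁ : Literature.NumberTheory.Automorphic.baseChange_cyclic_cuspidal)
    (h₂ : Literature.NumberTheory.Automorphic.ArthurClozel1989_strongLifting_archimedean)
    (h₃ : Literature.NumberTheory.Automorphic.Langlands1980_quadraticBaseChange_frobCompatible) :
    Summit.Langlands.Langlands.Theses.SkinnerWilesDefectOne.QuadraticBaseChangeGalois := by
  unfold Summit.Langlands.Langlands.Theses.SkinnerWilesDefectOne.QuadraticBaseChangeGalois
  exact quadraticBaseChangeGalois_of_facts h₁ h₂ h₃

end Summit.Langlands.Langlands.Theorems.SkinnerWilesDefectOne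

end
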